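import Literature.NumberTheory.Transcendental.FischlerRivoalCorollary1OfAndreBasis
import HarnessLib

/-!
# André's structure theorem for Э-functions at `z = 1` (named fact), and Fischler–Rivoal's Corollary 1 from it

Topic `Literature/NumberTheory/Transcendental`. Decomposition (librarian `fact-decompose`,
2026-08-16) of the XL named fact `FischlerRivoal2024_corollary1` (`FischlerRivoalCorollary1.lean`:
Fischler–Rivoal, J. Number Theory 261 (2024), Cor. 1 — under their Conjecture 2,
`∫₀^∞ (t+α)^s e^{−t} dt ∉ ℚ̄`). Its printed proof (§5.1, Prop. 4, "analogous to the end of the proof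
of [Beukers]"; §5.2) is PROVED in the tree up to one published input
(`FischlerRivoalCorollary1Proofs`, `…Reduction`, `…Operators`, `…OfAndre`, `…OfAndreBasis`:
`FischlerRivoal2024_corollary1_of_andreBasis (H) : FischlerRivoal2024_corollary1`), namely André's
structure theory of `E`-operators applied to Э-functions, which this file vendors as ONE named fact
(the hypothesis `H`, verbatim):

* Y. André, *Séries Gevrey de type arithmétique, I*, Ann. of Math. 151 (2000):
  **Thm. 4.6** (p. 725) « Soit `f(z)` une Э-fonction (ou plus généralement un élément holonome de
  `NGA{z}₊₁`). Alors `f(1/z)` est solution d'un `E`-opérateur. » and **Thm. 4.3 (i)** (structure des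
  `E`-opérateurs, pp. 721–722) « Soit `Φ ∈ K[z, d/dz]` un `E`-opérateur … (i) `Φ` n'a que deux
  singularités : `0` et `∞` », where (footnote 2, p. 707) « une singularité est dite triviale si
  l'opérateur différentiel y admet une base de solutions holomorphes ». Hence: for every Э-function
  `𝔤`, some non-zero `Φ ∈ ℚ̄[x, d/dx]` annihilates `𝔤(1/x)` and admits at `x = 1` a basis of
  `ord Φ` holomorphic solutions. In the variable `z = 1/x` (which fixes the point `1` and carries
  `ℂ[x, d/dx]` into `ℂ[z, z⁻¹, d/dz]`, cleared of denominators) and on Taylor expansions at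
  `z = 1` this is the statement `Andre2000_antiESeries_trivialSingularity_one` below — the form in
  which Fischler–Rivoal use it (§5.1, Prop. 4: "all solutions of `Ly = 0` are holomorphic … at `ξ`",
  `ξ = 1`; FR 2018, Amer. J. Math. 140, §4.3 for the reduction to `ξ = 1`).

`FischlerRivoal2024_corollary1_holds_of` is the decomposition assembly (one child; everything else
of the printed proof is already a theorem of the tree). No other definition.

## References

* [Andre2000GevreyI] Y. André, Ann. of Math. 151 (2000) 705–740: Thm. 4.2 (p. 721), Thm. 4.3 (i)
  (pp. 721–722), Thm. 4.6 (p. 725), footnote 2 (p. 707).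
* [FischlerRivoal2024] S. Fischler, T. Rivoal, J. Number Theory 261 (2024), §1 Cor. 1, §5.1
  Prop. 4, §5.2.
-/

noncomputable section

open Finset Complex
open scoped Nat

namespace Literature.NumberTheory.Transcendental

open Literature.Barriers.Schanuel Polynomial

/-- NAMED FACT — **André 2000, Thm. 4.6 with Thm. 4.3 (i): the differential equation of an
Э-function has only a trivial singularity at `z = 1`.** For every Э-function `𝔤 = ∑ n!·bₙ zⁿ`
(`antiESeries b`, `b` a strict `E`-coefficient sequence) there are `m` and polynomials
`Λ₀, …, Λ_m ∈ ℂ[z]`, `Λ_m ≠ 0`, such that `Λ = ∑_{k ≤ m} Λ_k(z) ∂ᵏ` annihilates `𝔤` in `ℂ⟦z⟧`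
and admits, at `z = 1`, `m` solutions `y₁, …, y_m ∈ ℂ⟦z − 1⟧` linearly independent over `ℂ`
(written in `t = z − 1`: `∑_k Λ_k(t + 1) ∂ₜᵏ yᵢ = 0` in `ℂ((t))`). Printed: « Soit `f(z)` une
Э-fonction … Alors `f(1/z)` est solution d'un `E`-opérateur » (Thm. 4.6) and « `Φ` [un
`E`-opérateur] n'a que deux singularités : `0` et `∞` » (Thm. 4.3 (i)), a singularity being trivial
when the operator « y admet une base de solutions holomorphes » (footnote 2); transported from
`x = 1/z` to `z` and to Taylor series at `1`. The input of Fischler–Rivoal 2024, §5.1, Prop. 4.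
[cite: Andre2000GevreyI, Thm. 4.6 (p. 725) and Thm. 4.3 (i) (pp. 721–722), footnote 2 (p. 707)]
[cite: FischlerRivoal2024, §5.1, Proposition 4] -/
def Andre2000_antiESeries_trivialSingularity_one : Prop :=
  ∀ (b : ℕ → ℂ), IsStrictEFunction b →
    ∃ (m : ℕ) (Λ : ℕ → Polynomial ℂ), Λ m ≠ 0 ∧
      (∑ k ∈ Finset.range (m + 1),
        (Λ k : PowerSeries ℂ) * (⇑(PowerSeries.derivative ℂ))^[k] (antiESeries b) = 0) ∧
      ∃ y : Fin m → PowerSeries ℂ, LinearIndependent ℂ y ∧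
        ∀ i, (∑ k ∈ Finset.range (m + 1),
          ((((Λ k).comp (Polynomial.X + Polynomial.C 1) : Polynomial ℂ) : PowerSeries ℂ) :
            LaurentSeries ℂ) * (⇑(LaurentSeries.derivative ℂ))^[k] (y i : LaurentSeries ℂ)) = 0

/-- **Fischler–Rivoal 2024, Corollary 1, from André's theorem** (decomposition assembly of the
named fact `FischlerRivoal2024_corollary1`): the tree's proved
`FischlerRivoal2024_corollary1_of_andreBasis` (Beukers' method for Э-functions made formal, §5.1
Prop. 4 and §5.2 of the source). [cite: FischlerRivoal2024, Corollary 1 (§1, p. 4), §5.1 and §5.2] -/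
theorem FischlerRivoal2024_corollary1_holds_of :
    Andre2000_antiESeries_trivialSingularity_one → FischlerRivoal2024_corollary1 :=
  FischlerRivoal2024_corollary1_of_andreBasis

end Literature.NumberTheory.Transcendental

end
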